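import Literature.NumberTheory.LFunctions.MertensNumberFieldConstant
import Literature.NumberTheory.LFunctions.IdealNormCount
import Literature.NumberTheory.Sieve.HeathBrownCubicMertensK
import HarnessLib

/-!
# Mertens' theorem for the prime ideals of a number field with the RESIDUE constant:
# `∏_{N𝔭 ≤ x} (1 − 1/N𝔭)^{-1} = e^{γ} κ_K log x (1 + o(1))` (Rosen 1999, Theorem 2), every number field

Topic `Literature/NumberTheory/LFunctions` (sequel of `MertensNumberFieldConstant.lean`).  Everything in this file
is PROVED (theorems and bookkeeping definitions with bodies; no named facts); it is a reproduction with citation of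
M. Rosen, *A generalization of Mertens' theorem*, J. Ramanujan Math. Soc. 14 (1999) 1–19, Theorem 2: for every
number field `K` with Dedekind zeta residue `κ_K`,

  `∑_{N𝔭 ≤ x} −log(1 − 1/N𝔭) = log log x + γ + log κ_K + O_K(1/log² x)`, i.e.
  `∏_{N𝔭 ≤ x} (1 − 1/N𝔭)^{-1} = e^{γ} κ_K · log x · (1 + O_K(1/log² x))`,

equivalently the identification of Mertens' constant `M_K` of `MertensNumberFieldConstant.exists_mertensConstant`:
`M_K = γ + log κ_K + ∑_𝔭 [log(1 − 1/N𝔭) + 1/N𝔭]`.  The tree had this only for `K = ℚ(∛2)`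
(`Literature/NumberTheory/Sieve/HeathBrownCubicMertensK.lean`, Heath-Brown (6.9)); the argument here is the same
(Hardy–Wright §22.8 transposed to `K`), organised by the NORM of the prime ideals instead of the rational prime
below (part I: the Euler product regrouped by the norm and the error terms `r_m`; part II, file
`MertensNumberFieldResidueLimit.lean`: the Abelian limits and the theorem):

* `normPrimeIdealCount_le_finrank` — `G(m) = #{𝔭 : N𝔭 = m} ≤ [K:ℚ]` (the primes of norm `p^f` lie over `p`);
* `normFibre`, `primesEquivNorm`, `wTerm`, `hasSum_wTerm` — `log ζ_K(s) = ∑_m G(m)·(−log(1 − m^{-s}))` for real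
  `s > 1` (the Euler product regrouped by the norm; `CubicSieve.hasSum_neg_log_one_sub_absNorm_rpow`);
* `rTerm`, `rTerm_bounds`, `abs_rTerm_le`, `continuousOn_rTerm` — `G(m)(−log(1 − m^{-s})) = G(m) m^{-s} + r_m(s)`,
  `0 ≤ r_m(s) ≤ 2[K:ℚ]/m²` for `s ≥ 1`, continuity in `s`;
* `summable_rTerm`, `tendsto_tsum_rTerm` — `∑_m r_m(1+σ) → ∑_m r_m(1)` (`σ → 0⁺`, dominated convergence);
* `abs_tsum_rTerm_shift_le` — the tail `|∑_m r_{m+N+1}(1)| ≤ 2[K:ℚ]/N` (`N ≥ 1`).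

## References

* M. Rosen, *A generalization of Mertens' theorem*, J. Ramanujan Math. Soc. 14 (1999) 1–19, Theorem 2.
  [Rosen1999Mertens]
* G. H. Hardy, E. M. Wright, *An Introduction to the Theory of Numbers*, §22.8, Theorem 428 (the method).
  [HardyWright2008]
* J. Neukirch, *Algebraic Number Theory*, Springer 1999, Prop. VII.5.2 (Euler product), I (8.2) (`∑ e_i f_i = n`).
  [NeukirchANT1999]
-/

noncomputable section

open Finset Real MeasureTheory Filter Set Topology NumberField IsDedekindDomain
open scoped NumberField

namespace Literature.NumberTheory.LFunctions.NumberField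

open Literature.NumberTheory.Sieve.CubicSieve (two_le_absNorm_asIdeal hasSum_neg_log_one_sub_absNorm_rpow
  neg_log_one_sub_bounds hasProd_realEulerFactor)

variable (K : Type*) [Field K] [NumberField K]

/-! ### `G(m) ≤ [K:ℚ]` -/

/-- **At most `[K:ℚ]` prime ideals have a given norm**: `G(m) ≤ [K:ℚ]` (a prime of norm `p^f` lies over `p`, and
at most `[K:ℚ] = ∑ eᵢfᵢ` primes lie over `p`). [cite: NeukirchANT1999, I (8.2)] -/
theorem normPrimeIdealCount_le_finrank (m : ℕ) : normPrimeIdealCount K m ≤ Module.finrank ℚ K := by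
  classical
  by_cases hm : IsPrimePow m
  · obtain ⟨p, k, hp, hk, rfl⟩ := hm
    have hp' : p.Prime := Nat.prime_iff.mpr hp
    haveI := Fact.mk hp'
    haveI : (Ideal.span {(p : ℤ)}).IsMaximal := Int.ideal_span_isMaximal_of_prime p
    have hfin := IsDedekindDomain.primesOver_finite (Ideal.span {(p : ℤ)}) (𝓞 K)
    refine le_trans ?_ (IdealNormCount.card_primesOver_le K hp')
    rw [normPrimeIdealCount, Nat.card_coe_set_eq]
    refine Set.ncard_le_ncard (fun P hP ↦ ?_) hfin
    obtain ⟨hPp, hP0, hN⟩ := hP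
    refine IdealNormCount.mem_primesOver_of_mem_normalizedFactors (K := K) hp' hN ?_
    rw [Ideal.mem_normalizedFactors_iff hP0]
    exact ⟨hPp, le_rfl⟩
  · rw [normPrimeIdealCount_eq_zero_of_not_isPrimePow K hm]; exact Nat.zero_le _

/-! ### The Euler product regrouped by the norm -/

/-- The (finite) set of nonzero prime ideals of norm `m`; it has `G(m)` elements. [folklore] -/
def normFibre (m : ℕ) : Finset (Ideal (𝓞 K)) := (finite_setOf_prime_absNorm_eq K m).toFinset

variable {K} in
/-- Membership in `normFibre` (Landau's `G(n)` counts it). [cite: LandauMathAnn1903, p. 669 (G(n))] -/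
theorem mem_normFibre {m : ℕ} {P : Ideal (𝓞 K)} :
    P ∈ normFibre K m ↔ P.IsPrime ∧ P ≠ ⊥ ∧ Ideal.absNorm P = m := by
  rw [normFibre, Set.Finite.mem_toFinset, Set.mem_setOf_eq]

/-- `#(normFibre m) = G(m)`. [cite: LandauMathAnn1903, p. 669 (G(n))] -/
theorem card_normFibre (m : ℕ) : (normFibre K m).card = normPrimeIdealCount K m := by
  rw [normPrimeIdealCount, normFibre, Set.ncard_eq_toFinset_card _ (finite_setOf_prime_absNorm_eq K m)]

/-- **The nonzero primes of `𝓞 K` ≃ pairs (norm `m`, prime of norm `m`).** [folklore] -/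
def primesEquivNorm : HeightOneSpectrum (𝓞 K) ≃ Σ m : ℕ, (normFibre K m) where
  toFun v := ⟨Ideal.absNorm v.asIdeal, ⟨v.asIdeal, mem_normFibre.mpr ⟨v.isPrime, v.ne_bot, rfl⟩⟩⟩
  invFun x := ⟨x.2.1, (mem_normFibre.mp x.2.2).1, (mem_normFibre.mp x.2.2).2.1⟩
  left_inv v := by ext1; rfl
  right_inv x := by
    obtain ⟨m, ⟨P, hP⟩⟩ := x
    have hm : Ideal.absNorm P = m := (mem_normFibre.mp hP).2.2
    refine Sigma.ext hm ?_
    exact (Subtype.heq_iff_coe_eq fun x => by dsimp only; rw [hm]).mpr rfl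

/-- The logarithmic Euler factors grouped by the norm: `w_m(s) = G(m) · (−log(1 − m^{-s}))`. [folklore] -/
def wTerm (m : ℕ) (s : ℝ) : ℝ := (normPrimeIdealCount K m : ℝ) * (-Real.log (1 - (m : ℝ) ^ (-s)))

/-- **`log ζ_K(s) = ∑_m G(m)(−log(1 − m^{-s}))`** for real `s > 1` (the Euler product of `ζ_K`, regrouped by the
norm of the prime ideals). [cite: NeukirchANT1999, Prop. VII.5.2] -/
theorem hasSum_wTerm {s : ℝ} (hs : 1 < s) :
    HasSum (fun m : ℕ => wTerm K m s) (Real.log (NumberField.dedekindZeta K s).re) := by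
  have h := hasSum_neg_log_one_sub_absNorm_rpow (L := K) hs
  rw [← (primesEquivNorm K).symm.hasSum_iff] at h
  set g : Ideal (𝓞 K) → ℝ := fun P => -Real.log (1 - ((Ideal.absNorm P : ℕ) : ℝ) ^ (-s)) with hg
  have hfib : ∀ m : ℕ, HasSum (fun c : (normFibre K m) =>
      ((fun v : HeightOneSpectrum (𝓞 K) => -Real.log (1 - (Ideal.absNorm v.asIdeal : ℝ) ^ (-s))) ∘
        (primesEquivNorm K).symm) ⟨m, c⟩) (wTerm K m s) := by
    intro m
    have h1 := hasSum_fintype (fun c : (normFibre K m) => g (c : Ideal (𝓞 K)))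
    rw [Finset.sum_coe_sort] at h1
    have hsum : ∑ P ∈ normFibre K m, g P = wTerm K m s := by
      have hcongr : ∀ P ∈ normFibre K m, g P = -Real.log (1 - (m : ℝ) ^ (-s)) := by
        intro P hP; rw [hg]; dsimp only; rw [(mem_normFibre.mp hP).2.2]
      rw [Finset.sum_congr rfl hcongr, Finset.sum_const, nsmul_eq_mul, card_normFibre, wTerm]
    rw [hsum] at h1
    exact h1
  exact h.sigma hfib

/-! ### `w_m(s) = G(m) m^{-s} + r_m(s)`, `0 ≤ r_m(s) ≤ 2[K:ℚ]/m²` -/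

/-- The error term `r_m(s) = G(m)(−log(1 − m^{-s}) − m^{-s})`. [folklore] -/
def rTerm (m : ℕ) (s : ℝ) : ℝ := wTerm K m s - (normPrimeIdealCount K m : ℝ) * (m : ℝ) ^ (-s)

/-- `r_m(s) = G(m) · (−log(1 − m^{-s}) − m^{-s})`. [cite: HardyWright2008, §22.8 (proof of Theorem 428)] -/
theorem rTerm_eq (m : ℕ) (s : ℝ) :
    rTerm K m s = (normPrimeIdealCount K m : ℝ) * (-Real.log (1 - (m : ℝ) ^ (-s)) - (m : ℝ) ^ (-s)) := by
  rw [rTerm, wTerm]; ring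

/-- `r_0(s) = r_1(s) = 0` (no prime ideals of norm `0` or `1`). [cite: HardyWright2008, §22.8 (proof of Theorem 428)] -/
theorem rTerm_of_lt_two {m : ℕ} (hm : m < 2) (s : ℝ) : rTerm K m s = 0 := by
  rw [rTerm_eq]
  interval_cases m <;> simp

/-- **`0 ≤ r_m(s) ≤ 2[K:ℚ]/m²` for `s ≥ 1`** (`m ≥ 2`: `u = m^{-s} ≤ 1/2`, `0 ≤ −log(1−u) − u ≤ 2u² ≤ 2/m²`,
times `G(m) ≤ [K:ℚ]`). [cite: HardyWright2008, §22.8 (proof of Theorem 428)] -/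
theorem rTerm_bounds {m : ℕ} (hm : 2 ≤ m) {s : ℝ} (hs : 1 ≤ s) :
    0 ≤ rTerm K m s ∧ rTerm K m s ≤ 2 * (Module.finrank ℚ K : ℝ) / (m : ℝ) ^ 2 := by
  have hm2 : (2 : ℝ) ≤ m := by exact_mod_cast hm
  have hm0 : (0 : ℝ) < m := by linarith
  set u : ℝ := (m : ℝ) ^ (-s) with hu
  have hu0 : 0 ≤ u := (Real.rpow_pos_of_pos hm0 _).le
  have hum : u ≤ (m : ℝ)⁻¹ := by
    rw [hu, ← Real.rpow_neg_one]; exact Real.rpow_le_rpow_of_exponent_le (by linarith) (by linarith)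
  have hu2 : u ≤ 1 / 2 := hum.trans (by rw [inv_eq_one_div]; exact one_div_le_one_div_of_le two_pos hm2)
  obtain ⟨h1, h2, -, -⟩ := neg_log_one_sub_bounds hu0 hu2
  have hG0 : (0 : ℝ) ≤ normPrimeIdealCount K m := Nat.cast_nonneg _
  have hGn : (normPrimeIdealCount K m : ℝ) ≤ Module.finrank ℚ K := by
    exact_mod_cast normPrimeIdealCount_le_finrank K m
  rw [rTerm_eq]
  refine ⟨mul_nonneg hG0 h1, ?_⟩
  have hu2' : u ^ 2 ≤ ((m : ℝ)⁻¹) ^ 2 := pow_le_pow_left₀ hu0 hum 2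
  rw [inv_pow] at hu2'
  calc (normPrimeIdealCount K m : ℝ) * (-Real.log (1 - u) - u)
      ≤ (Module.finrank ℚ K : ℝ) * (2 * u ^ 2) := mul_le_mul hGn h2 h1 (Nat.cast_nonneg _)
    _ ≤ (Module.finrank ℚ K : ℝ) * (2 * ((m : ℝ) ^ 2)⁻¹) := by gcongr
    _ = 2 * (Module.finrank ℚ K : ℝ) / (m : ℝ) ^ 2 := by rw [div_eq_mul_inv]; ring

/-- `|r_m(s)| ≤ 2[K:ℚ]/m²` for all `m` and `s ≥ 1`. [cite: HardyWright2008, §22.8 (proof of Theorem 428)] -/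
theorem abs_rTerm_le (m : ℕ) {s : ℝ} (hs : 1 ≤ s) :
    |rTerm K m s| ≤ 2 * (Module.finrank ℚ K : ℝ) / (m : ℝ) ^ 2 := by
  rcases Nat.lt_or_ge m 2 with hm | hm
  · rw [rTerm_of_lt_two K hm, abs_zero]; positivity
  · obtain ⟨h0, h1⟩ := rTerm_bounds K hm hs
    rw [abs_of_nonneg h0]; exact h1

/-- `s ↦ r_m(s)` is continuous on `(0, ∞)`. [cite: HardyWright2008, §22.8 (proof of Theorem 428)] -/
theorem continuousOn_rTerm (m : ℕ) : ContinuousOn (fun s => rTerm K m s) (Set.Ioi 0) := by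
  rcases Nat.lt_or_ge m 2 with hm | hm
  · have : (fun s => rTerm K m s) = fun _ => 0 := funext fun s => rTerm_of_lt_two K hm s
    rw [this]; exact continuousOn_const
  · have hm0 : (0 : ℝ) < m := by exact_mod_cast (lt_of_lt_of_le (by norm_num) hm)
    have hm2 : (2 : ℝ) ≤ m := by exact_mod_cast hm
    simp only [rTerm_eq]
    refine continuousOn_const.mul (ContinuousOn.sub (ContinuousOn.neg (ContinuousOn.log ?_ fun s hs => ?_)) ?_)
    · exact continuousOn_const.sub (continuousOn_const.rpow continuousOn_id.neg fun _ _ => Or.inl hm0.ne')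
    · have : (m : ℝ) ^ (-s) < 1 := Real.rpow_lt_one_of_one_lt_of_neg (by linarith) (by simpa using hs)
      linarith
    · exact continuousOn_const.rpow continuousOn_id.neg fun _ _ => Or.inl hm0.ne'

/-! ### Summability and the limit `σ → 0⁺` of the error terms -/

/-- `∑_m r_m(s)` converges for `s ≥ 1` (dominated by `2[K:ℚ]/m²`). [cite: Rosen1999Mertens, §2 (proof of Theorem 2)] -/
theorem summable_rTerm {s : ℝ} (hs : 1 ≤ s) : Summable fun m : ℕ => rTerm K m s := by
  refine Summable.of_norm_bounded ((Real.summable_nat_pow_inv.mpr one_lt_two).mul_left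
    (2 * (Module.finrank ℚ K : ℝ))) fun m => ?_
  rw [Real.norm_eq_abs, ← div_eq_mul_inv]; exact abs_rTerm_le K m hs

/-- `∑_m r_m(1+σ) → ∑_m r_m(1)` as `σ → 0⁺` (dominated convergence with `2[K:ℚ]/m²`). [cite: Rosen1999Mertens, §2 (proof of Theorem 2)] -/
theorem tendsto_tsum_rTerm :
    Tendsto (fun σ : ℝ => ∑' m : ℕ, rTerm K m (1 + σ)) (𝓝[>] 0) (𝓝 (∑' m : ℕ, rTerm K m 1)) := by
  have hbound : Summable fun m : ℕ => 2 * (Module.finrank ℚ K : ℝ) * ((m : ℝ) ^ 2)⁻¹ :=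
    (Real.summable_nat_pow_inv.mpr one_lt_two).mul_left _
  refine tendsto_tsum_of_dominated_convergence hbound (fun m => ?_) ?_
  · have hc : ContinuousAt (fun s => rTerm K m s) 1 := (continuousOn_rTerm K m).continuousAt (Ioi_mem_nhds one_pos)
    have h1 : Tendsto (fun σ : ℝ => 1 + σ) (𝓝[>] 0) (𝓝 1) := by
      have : Tendsto (fun σ : ℝ => 1 + σ) (𝓝 0) (𝓝 (1 + 0)) := (continuous_const.add continuous_id).tendsto 0
      rw [add_zero] at this
      exact tendsto_nhdsWithin_of_tendsto_nhds this
    exact hc.tendsto.comp h1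
  · filter_upwards [self_mem_nhdsWithin] with σ (hσ : 0 < σ)
    intro m
    rw [Real.norm_eq_abs, ← div_eq_mul_inv]
    exact abs_rTerm_le K m (by linarith)

/-- **Tail of the error terms**: `|∑_m r_{m+N+1}(1)| ≤ 2[K:ℚ]/N` for `N ≥ 1`
(from `∑_{n ≥ 0} 1/(n+N+1)² ≤ 1/N`, tree `CubicSieve.tsum_inv_sq_tail_le`). [cite: Rosen1999Mertens, §2 (proof of Theorem 2)] -/
theorem abs_tsum_rTerm_shift_le {N : ℕ} (hN : 1 ≤ N) :
    |∑' m : ℕ, rTerm K (m + (N + 1)) 1| ≤ 2 * (Module.finrank ℚ K : ℝ) / N := by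
  set d : ℝ := (Module.finrank ℚ K : ℝ) with hd
  have hsum : Summable fun m : ℕ => rTerm K (m + (N + 1)) 1 :=
    (summable_rTerm K le_rfl).comp_injective (add_left_injective (N + 1))
  have hb : ∀ m : ℕ, |rTerm K (m + (N + 1)) 1| ≤ 2 * d * (1 / (((m + (N + 1)) : ℕ) : ℝ) ^ 2) := by
    intro m
    have h := abs_rTerm_le K (m + (N + 1)) le_rfl
    rw [mul_one_div]; exact h
  have htail := Literature.NumberTheory.Sieve.CubicSieve.tsum_inv_sq_tail_le hN
  have hsb : Summable fun m : ℕ => 2 * d * (1 / (((m + (N + 1)) : ℕ) : ℝ) ^ 2) := by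
    refine Summable.mul_left (2 * d) ?_
    have : Summable fun n : ℕ => 1 / ((n : ℕ) : ℝ) ^ 2 := by
      simp only [one_div]; exact Real.summable_nat_pow_inv.mpr one_lt_two
    exact this.comp_injective (add_left_injective (N + 1))
  have hd0 : 0 ≤ 2 * d := by positivity
  calc |∑' m : ℕ, rTerm K (m + (N + 1)) 1| ≤ ∑' m : ℕ, |rTerm K (m + (N + 1)) 1| := by
        have := norm_tsum_le_tsum_norm hsum.norm
        simpa only [Real.norm_eq_abs] using this
    _ ≤ ∑' m : ℕ, 2 * d * (1 / (((m + (N + 1)) : ℕ) : ℝ) ^ 2) := Summable.tsum_le_tsum hb hsum.abs hsb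
    _ = 2 * d * ∑' m : ℕ, 1 / (((m + (N + 1)) : ℕ) : ℝ) ^ 2 := tsum_mul_left
    _ ≤ 2 * d * (1 / (N : ℝ)) := mul_le_mul_of_nonneg_left htail hd0
    _ = 2 * d / N := by ring

end Literature.NumberTheory.LFunctions.NumberField

end
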